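import Literature.AlgebraicGeometry.Resolution.PointBlowupAdaptedOrder
import Mathlib.RingTheory.PowerSeries.Substitution
import Mathlib.Data.Prod.Lex
import Mathlib.FieldTheory.IsAlgClosed.Basic

/-!
# Hauser–Wagner's height, bonus, intricacy and slope for purely inseparable surfaces (statement level)

Hauser and Wagner [cite: HauserWagner2014] give two local resolution invariants for a purely
inseparable two-dimensional hypersurface `G = x^p + F(y,z)` over an algebraically closed field of
characteristic `p` which DECREASE under every point blow-up (Theorem 2), built from measures of
the Newton polygon of the class `f` of `F` in `R/R^p` relative to a local flag.  This file types,
over the `MvPolynomial` model of the atlas (`PointBlowup.State`, `PointBlowup.step` of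
`Literature.AlgebraicGeometry.Resolution.PointBlowupShade`), with each published definition quoted:

* §4: for an expansion `F` in coordinates `(y, z)` subordinate to the flag `z = 0` (HW's `y` is the
  FREE variable `free`, `z` the RIGID one `rig`): `ord_y F`, `Degree_y F` (the free component of the
  highest vertex of the Newton polygon), `Height(F) = Degree_y(F) − Order_y(F)`, the adjacency
  (adjacent / close / distant: `ord_y F = 0 / = 1 / ≥ 2`), `Bonus(F) ∈ {1 + δ, ε, 0}` with HW's free
  parameters `0 < ε < δ < 1`, the intricacy `Height − Bonus`, `Slope(F) = α₁(β₂ − β₁)/(α₁ − α₂)`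
  (`⊤` for a quadrant) and the adjusted height vector `(intricacy, slope)` ordered lexicographically;
* §6.1 (V): `Width(F)` and quasi-monomials;
* §9.1: `Dorder`, `Dent = (updent, indent)`, `Defect`, the second vector `(Dorder − Defect, Dent)`;
* §5: the three moves — translational `F(yz + tz, z)`, horizontal `F(yz, z)`, vertical `F(y, yz)` —
  are `PointBlowup.step` in the chart of the rigid variable at the point `t` of the free axis, resp.
  in the chart of the free variable at its origin (HW keep the exceptional monomials in `F` and work
  with the total transform divided by the `p`-th power of the chart variable, Remark 8); the induced
  flag is `z = 0` again in all three cases (§5), so the pair `(rig, free)` is transported unchanged;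
* the coordinate-free height of §4 (p. 186–187): `height_a(f) = Degree_y(F) − max {ord_y F : (y,z)
  subordinate}`; subordinate changes may be taken triangular, `y ↦ y + φ(z)` (Remark 4), and `F` is a
  class modulo `p`-th powers, so `ord_y ≥ m` after the change means: the substituted series lies in
  `y^m·K[[y,z]] + K[[y^p, z^p]]`.  This is typed with `MvPowerSeries.subst` as `OrdFreeAtLeast` and a
  supremum `maxOrdFree`; the coordinate-free slope (a maximum over realising representatives of a
  Newton-polygon datum of a power series) is NOT typed here.

Edge predicates compare the vectors of `s.F` and `(step p j b s).F` in the GIVEN, transported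
coordinates (`HeightVectorDrops` …), which is what the atlas evaluates; HW's Theorem 2 (i) concerns
the coordinate-free vector and is recorded, NOT asserted, as the named proposition
`IntricacyNonincreaseStatement` for its first component.  Typed transcription of definitions for an
observatory; not a resolution theorem, and nothing printed is asserted as a Lean theorem here.
-/

noncomputable section

open MvPolynomial Finset

namespace Literature.AlgebraicGeometry.Resolution

open Literature.AlgebraicGeometry.Resolution.Hauser2010
open Literature.AlgebraicGeometry.Resolution.PointBlowup

namespace HauserWagner2014

variable {σ : Type*} {K : Type*} [CommRing K]

/-! ### §4 — measures of an expansion `F` relative to (rigid, free) -/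

/-- `ord_{y_i}(F)`, the least exponent of `y_i` in the support of `F` (as a natural number; `0` for `F = 0`).
[cite: HauserWagner2014, §4 p. 186 (Order_y)] -/
def ordVar (F : MvPolynomial σ K) (i : σ) : ℕ := (bigH F i).toNat

/-- the lowest face of the support in the rigid direction: the exponents `d` with `d_rig = ord_rig F`
(it carries the highest vertex of the Newton polygon). [cite: HauserWagner2014, §4 p. 186] -/
def lowFace (F : MvPolynomial σ K) (rig : σ) : Finset (σ →₀ ℕ) :=
  F.support.filter fun d => d rig = ordVar F rig

/-- `Degree_y(F) = α₁`, the free component of the highest vertex `(α₁, β₁)` of the Newton polygon ("the vertex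
whose first component has the highest value among all vertices", `β₁ = ord_z F`): the least free exponent on the
lowest rigid face. [cite: HauserWagner2014, §4 p. 186 (Degree_y)] -/
def degAlong (F : MvPolynomial σ K) (rig free : σ) : ℕ :=
  ((lowFace F rig).inf fun d => ((d free : ℕ) : ℕ∞)).toNat

/-- "`Height(F) = Degree_y(F) − Order_y(F)`"; equivalently the order of `H(y, 0)` for `F = y^k z^n·H` with `H` prime to
`y` and `z`. [cite: HauserWagner2014, §4 p. 186 and Remark 2] -/
def height (F : MvPolynomial σ K) (rig free : σ) : ℕ := degAlong F rig free - ordVar F free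

/-- "`Width(F) = deg_z(F) − Order_z(F)`": the height with the two variables exchanged. [cite: HauserWagner2014, §6.1 (V)] -/
def width (F : MvPolynomial σ K) (rig free : σ) : ℕ := degAlong F free rig - ordVar F rig

/-- the three adjacency classes of an expansion. [cite: HauserWagner2014, §4 p. 186] -/
inductive Adjacency
  /-- `ord_y F = 0`: the Newton polygon touches the rigid axis -/
  | adjacent
  /-- `ord_y F = 1` -/
  | close
  /-- `ord_y F ≥ 2` -/
  | distant
  deriving DecidableEq, Repr

/-- "We call `F` adjacent if `ord_y F = 0`, close if `ord_y F = 1`, and distant if `ord_y F ≥ 2`."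
[cite: HauserWagner2014, §4 p. 186] -/
def adjacency (F : MvPolynomial σ K) (free : σ) : Adjacency :=
  match ordVar F free with
  | 0 => .adjacent
  | 1 => .close
  | _ => .distant

/-- HW's number `Adj(F) ∈ {2, 1, 0}` (adjacent, close, distant). [cite: HauserWagner2014, §6.1 (before Lemma 1)] -/
def Adjacency.num : Adjacency → ℕ
  | .adjacent => 2
  | .close => 1
  | .distant => 0

/-- HW's free parameters: "`ε, δ` denote arbitrarily chosen positive numbers between `0` and `1` with `ε < δ`".
[cite: HauserWagner2014, §4 p. 187] -/
def AdmissibleParams (ε δ : ℚ) : Prop := 0 < ε ∧ ε < δ ∧ δ < 1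

/-- "`Bonus(F) = 1 + δ` if `F` is adjacent, `ε` if `F` is close, `0` if `F` is distant." [cite: HauserWagner2014, §4 p. 187] -/
def bonus (ε δ : ℚ) (F : MvPolynomial σ K) (free : σ) : ℚ :=
  match adjacency F free with
  | .adjacent => 1 + δ
  | .close => ε
  | .distant => 0

/-- the intricacy `Height(F) − Bonus(F)` of an expansion (HW's "adjusted height"; the invariant takes its minimum over
subordinate coordinates). [cite: HauserWagner2014, §4 p. 187] -/
def intricacy (ε δ : ℚ) (F : MvPolynomial σ K) (rig free : σ) : ℚ :=
  (height F rig free : ℚ) - bonus ε δ F free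

/-- "adjacent series `F` with `Width(F) = 1` are called quasi-monomials" (they are resolved by line blow-ups and are
the exception in Theorem 2). [cite: HauserWagner2014, §6.1 (V), Remark 12] -/
def IsQuasiMonomial (F : MvPolynomial σ K) (rig free : σ) : Prop :=
  width F rig free = 1 ∧ ordVar F free = 0

/-- the support points strictly left of the highest vertex in the free direction (`d_free < α₁`; then `d_rig > β₁`).
[folklore] -/
def lowerSupport (F : MvPolynomial σ K) (rig free : σ) : Finset (σ →₀ ℕ) :=
  F.support.filter fun d => d free < degAlong F rig free

/-- the reciprocal steepness `(β − β₁)/(α₁ − α)` of the segment from the highest vertex to a lower support point.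
[folklore] -/
def edgeRatio (F : MvPolynomial σ K) (rig free : σ) (d : σ →₀ ℕ) : ℚ :=
  ((d rig : ℚ) - ordVar F rig) / ((degAlong F rig free : ℚ) - d free)

/-- "`Slope(F) = α₁/(α₁ − α₂) · (β₂ − β₁)`" where `(α₂, β₂)` is the second highest vertex, i.e. `α₁` times the least
edge ratio over the lower support; `⊤` ("`Slope(F) = ∞`") if the Newton polygon is a quadrant.
[cite: HauserWagner2014, §4 p. 187 (Slope)] -/
def slope (F : MvPolynomial σ K) (rig free : σ) : WithTop ℚ :=
  (lowerSupport F rig free).inf fun d => (((degAlong F rig free : ℚ) * edgeRatio F rig free d : ℚ) : WithTop ℚ)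

/-- the adjusted height vector `(intricacy, slope)` of an expansion, "considered with respect to the lexicographic
order". [cite: HauserWagner2014, §4 p. 187 (i_a(f))] -/
def heightVector (ε δ : ℚ) (F : MvPolynomial σ K) (rig free : σ) : ℚ ×ₗ WithTop ℚ :=
  toLex (intricacy ε δ F rig free, slope F rig free)

/-! ### §9.1 — the second invariant's measures -/

/-- "`Dorder(F) = ord(F) − Order_y(F) − Order_z(F)`", the order of `H` for `F = y^m z^n·H` with the maximal monomial
factored (the atlas' `shade_mm`). [cite: HauserWagner2014, §9.1] -/
def dorder (F : MvPolynomial σ K) (rig free : σ) : ℕ :=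
  (ordZero F).toNat - ordVar F rig - ordVar F free

/-- the support points spanning the steepest edge from the highest vertex (those of least edge ratio); its far end is
the second highest vertex `(α₂, β₂)`. [cite: HauserWagner2014, §9.1] -/
def steepest (F : MvPolynomial σ K) (rig free : σ) : Finset (σ →₀ ℕ) :=
  (lowerSupport F rig free).filter fun d => ∀ d' ∈ lowerSupport F rig free, edgeRatio F rig free d ≤ edgeRatio F rig free d'

/-- `Updent(F) = α₁ − α₂`. [cite: HauserWagner2014, §9.1 (Dent)] -/
def updent (F : MvPolynomial σ K) (rig free : σ) : ℕ :=
  degAlong F rig free - ((steepest F rig free).inf fun d => ((d free : ℕ) : ℕ∞)).toNat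

/-- `Indent(F) = β₂ − β₁`. [cite: HauserWagner2014, §9.1 (Dent)] -/
def indent (F : MvPolynomial σ K) (rig free : σ) : ℕ :=
  ((steepest F rig free).sup fun d => d rig) - ordVar F rig

/-- "`Dent(F) = (α₁ − α₂, β₂ − β₁)`" (defined when the Newton polygon is not a quadrant), ordered lexicographically
"with `(0,1) < (1,0)`". [cite: HauserWagner2014, §9.1] -/
def dent (F : MvPolynomial σ K) (rig free : σ) : ℕ ×ₗ ℕ := toLex (updent F rig free, indent F rig free)

/-- the Newton polygon is a quadrant (a monomial times a unit in the given coordinates: no lower support).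
[cite: HauserWagner2014, §4 p. 187] -/
def IsQuadrant (F : MvPolynomial σ K) (rig free : σ) : Prop := lowerSupport F rig free = ∅

/-- "If `Dorder(F) = Degree_y(F) − Order_y(F)`, the defect is `1 + δ` for `F` adjacent, `ε` for `F` close and `0`
otherwise. If `Dorder(F) = Degree_y(F) − Order_y(F) − 1`, it is `δ` for `F` adjacent and `0` otherwise. And if
`Dorder(F) ≤ Degree_y(F) − Order_y(F) − 2`, it is `0`." [cite: HauserWagner2014, §9.1 (Defect)] -/
def defect (ε δ : ℚ) (F : MvPolynomial σ K) (rig free : σ) : ℚ :=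
  match height F rig free - dorder F rig free with
  | 0 => bonus ε δ F free
  | 1 => if adjacency F free = .adjacent then δ else 0
  | _ => 0

/-- the second vector `(Dorder − Defect, Dent)` of an expansion (HW's `j_a(f)` takes `Dorder − Defect` minimal, then
`Updent` minimal, then `Indent` maximal over subordinate coordinates). [cite: HauserWagner2014, §9.1 (j_a(f))] -/
def secondVector (ε δ : ℚ) (F : MvPolynomial σ K) (rig free : σ) : ℚ ×ₗ (ℕ ×ₗ ℕ) :=
  toLex ((dorder F rig free : ℚ) - defect ε δ F rig free, dent F rig free)

/-! ### §5 — the moves as steps of the atlas, and the edge predicates -/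

variable [DecidableEq σ] [DecidableEq K]

/-- the translational (`t ≠ 0`) / horizontal (`t = 0`) move "`F*(y,z) = F(yz + tz, z)`" followed by the division by
`z^p` and cleaning: the atlas step in the chart of the rigid variable at the point `t` of the free axis.
[cite: HauserWagner2014, §5 (moves (T), (H)) and Remark 8] -/
def moveT (p : ℕ) (rig free : σ) (t : K) (s : State σ K) : State σ K :=
  step p rig (Function.update (0 : σ → K) free t) s

/-- the vertical move "`F*(y,z) = F(y, yz)`" followed by division by `y^p` and cleaning: the atlas step in the chart
of the free variable at its origin. [cite: HauserWagner2014, §5 (move (V)) and Remark 8] -/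
def moveV (p : ℕ) (free : σ) (s : State σ K) : State σ K :=
  step p free (0 : σ → K) s

/-- the adjusted height vector of the transform, in the transported coordinates, is lexicographically smaller.
[cite: HauserWagner2014, Theorem 2 (i) (the property, evaluated in given coordinates)] -/
def HeightVectorDrops (ε δ : ℚ) (p : ℕ) (rig free j : σ) (b : σ → K) (s : State σ K) : Prop :=
  heightVector ε δ (step p j b s).F rig free < heightVector ε δ s.F rig free

/-- the intricacy of the transform (given coordinates) is smaller. [cite: HauserWagner2014, Proposition 1] -/
def IntricacyDrops (ε δ : ℚ) (p : ℕ) (rig free j : σ) (b : σ → K) (s : State σ K) : Prop :=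
  intricacy ε δ (step p j b s).F rig free < intricacy ε δ s.F rig free

/-- the intricacy of the transform (given coordinates) is the same. [cite: HauserWagner2014, §6.2] -/
def IntricacyStalls (ε δ : ℚ) (p : ℕ) (rig free j : σ) (b : σ → K) (s : State σ K) : Prop :=
  intricacy ε δ (step p j b s).F rig free = intricacy ε δ s.F rig free

/-- the intricacy of the transform (given coordinates) is larger — excluded by Proposition 1 in REALISING coordinates
for non-quasi-monomials; in given coordinates it flags a non-realising expansion. [cite: HauserWagner2014, Proposition 1] -/
def IntricacyIncreases (ε δ : ℚ) (p : ℕ) (rig free j : σ) (b : σ → K) (s : State σ K) : Prop :=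
  intricacy ε δ s.F rig free < intricacy ε δ (step p j b s).F rig free

/-- the second vector of the transform (given coordinates) is lexicographically smaller.
[cite: HauserWagner2014, §9.3 (decrease of j_a)] -/
def SecondVectorDrops (ε δ : ℚ) (p : ℕ) (rig free j : σ) (b : σ → K) (s : State σ K) : Prop :=
  secondVector ε δ (step p j b s).F rig free < secondVector ε δ s.F rig free

/-! ### §4 — the coordinate-free height (subordinate coordinate changes) -/

omit [DecidableEq K] in
/-- the expansion after the triangular subordinate change `y_free ↦ y_free + φ(y_rig)` (`φ(0) = 0`), as a formal power
series ("it suffices to consider coordinate changes of this form", Remark 4). [cite: HauserWagner2014, §4 Remark 4] -/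
def substFree (rig free : σ) (φ : PowerSeries K) (F : MvPolynomial σ K) : MvPowerSeries σ K :=
  MvPowerSeries.subst
    (fun i => if i = free then (MvPowerSeries.X free : MvPowerSeries σ K) + PowerSeries.subst (MvPowerSeries.X rig) φ
      else MvPowerSeries.X i)
    (F : MvPowerSeries σ K)

omit [DecidableEq K] in
/-- `ord_free ≥ m` for the CLASS of the substituted series modulo `p`-th powers: it lies in
`y_free^m · K[[y]] + K[[y_1^p, …, y_n^p]]` (the second summand is what the cleaning `x ↦ x + h` removes).
[cite: HauserWagner2014, §4 p. 186 (F as an element of R/R^p; ord_y of its expansion)] -/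
def OrdFreeAtLeast (p : ℕ) (rig free : σ) (φ : PowerSeries K) (m : ℕ) (F : MvPolynomial σ K) : Prop :=
  ∃ A : MvPowerSeries σ K, ∀ d : σ →₀ ℕ,
    MvPowerSeries.coeff d (substFree rig free φ F - MvPowerSeries.X free ^ m * A) ≠ 0 → ∀ i, p ∣ d i

omit [DecidableEq K] in
/-- "`max {ord_y(F) ; (y, z) ∈ C}`": the largest free order over subordinate coordinates (a supremum of naturals; for a
cleaned `F ≠ 0` it is bounded by `ord F`). [cite: HauserWagner2014, §4 p. 187 (height(f))] -/
def maxOrdFree (p : ℕ) (F : MvPolynomial σ K) (rig free : σ) : ℕ :=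
  sSup {m : ℕ | ∃ φ : PowerSeries K, PowerSeries.constantCoeff φ = 0 ∧ OrdFreeAtLeast p rig free φ m F}

omit [DecidableEq K] in
/-- "`height_a(f) = min {height(F)} = Degree_y(F) − max {ord_y(F)}` over subordinate coordinates" (`Degree_y` does not
depend on them). [cite: HauserWagner2014, §4 p. 187 (height(f))] -/
def heightAt (p : ℕ) (F : MvPolynomial σ K) (rig free : σ) : ℕ := degAlong F rig free - maxOrdFree p F rig free

omit [DecidableEq K] in
/-- the given coordinates REALISE the height: no subordinate change raises `ord_free` ("subordinate coordinates
realizing the height of `f`"). [cite: HauserWagner2014, §4 p. 187] -/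
def Realizes (p : ℕ) (F : MvPolynomial σ K) (rig free : σ) : Prop := maxOrdFree p F rig free = ordVar F free

omit [DecidableEq K] in
/-- the adjacency of `f` at `a` = that of any realising expansion, read off `max ord_y`. [cite: HauserWagner2014, §6.1 (Adj(f))] -/
def adjacencyAt (p : ℕ) (F : MvPolynomial σ K) (rig free : σ) : Adjacency :=
  match maxOrdFree p F rig free with
  | 0 => .adjacent
  | 1 => .close
  | _ => .distant

omit [DecidableEq K] in
/-- "`intricacy_a(f) = height_a(f) − bonus_a(f) = min {Height(F) − Bonus(F)}`". [cite: HauserWagner2014, §4 p. 187] -/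
def intricacyAt (ε δ : ℚ) (p : ℕ) (F : MvPolynomial σ K) (rig free : σ) : ℚ :=
  (heightAt p F rig free : ℚ) -
    (match adjacencyAt p F rig free with
      | .adjacent => 1 + δ
      | .close => ε
      | .distant => 0)

/-- The first-component consequence of [cite: HauserWagner2014, Theorem 2 (i) with Proposition 1]: for `K`
algebraically closed of characteristic `p`, at every closed point of the exceptional curve — the points `t` of the
free axis in the chart of the rigid variable and the origin of the chart of the free variable — the coordinate-free
intricacy w.r.t. the transported flag does not exceed the one below, unless the realising expansion is a
quasi-monomial.  Recorded as a NAMED PROPOSITION for the observatory (hypotheses as HW state them: `F` a cleaned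
expansion realising the height); it is NOT asserted here. [cite: HauserWagner2014, Theorem 2 (i), Proposition 1] -/
def IntricacyNonincreaseStatement (ε δ : ℚ) (p : ℕ) (K : Type*) [Field K] [CharP K p] [IsAlgClosed K]
    [DecidableEq K] : Prop :=
  ∀ (s : State (Fin 2) K) (rig free : Fin 2), rig ≠ free → AdmissibleParams ε δ →
    s.F ≠ 0 → deletePthPowers p s.F = s.F → (p : ℕ∞) ≤ ordZero s.F → Realizes p s.F rig free →
    ¬ IsQuasiMonomial s.F rig free → 0 < height s.F rig free →
      (∀ t : K, intricacyAt ε δ p (moveT p rig free t s).F rig free ≤ intricacyAt ε δ p s.F rig free) ∧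
        intricacyAt ε δ p (moveV p free s).F rig free ≤ intricacyAt ε δ p s.F rig free

end HauserWagner2014

end Literature.AlgebraicGeometry.Resolution
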